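import Summits.BirchSwinnertonDyer.BirchSwinnertonDyer.Theorems.ManinLocalTwoThreeBoundaryHeckeOperators
import HarnessLib

/-!
# The Hecke operators commute on the boundary symbols of `Γ₀(M)`

Summit `BirchSwinnertonDyer`, route `ManinLocalTwoThree` (cell bsd-f2-manin), cruxes C2 `ManinOddAtFour`
(stmt-BirchSwinnertonDyer-22967) / C3 `ManinPrimeToThreeAtNine` (stmt-BirchSwinnertonDyer-22968).  Complement to
`Theorems/ManinLocalTwoThreeBoundaryHeckeOperators.lean` for the line prover p3's assembly of E-es-35 (plan (B), cell INBOX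
2026-08-28T03:17:26Z: the projectors `q_r(T_r)` onto the `λ(r)`-primary parts of the boundary module must commute): on
`B_M = boundaryOf K (cuspInvariants M K)` and for primes `q, r ∤ M`,

* `T_q T_r = T_r T_q` (`symbolHecke_comm_of_mem`) — both equal `A_qA_r + r A_qB_r + q B_qA_r + qr B_qB_r` with all four
  shift operators commuting (`B_r = A_r⁻¹`);
* `B_q B_r = B_r B_q` (`symbolShift_zero_comm`);
* `T_q` preserves `B_M ∩` (generalised `μ`-eigenspace of `T_r`) (`symbolHecke_mem_maxGenEigenspace`).

No new definitions; nothing about BSD or Manin's conjecture is proved here.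

References: G. Shimura (1971) §8.3, Thm. 3.41 (commutativity of Hecke operators); cell memo HOME/MEMO-es.md §22.3.
-/

set_option autoImplicit false
set_option linter.dupNamespace false

open scoped MatrixGroups

open CongruenceSubgroup Matrix.SpecialLinearGroup Literature.NumberTheory.EllipticCurves.ModularForms

namespace Summit.BirchSwinnertonDyer.BirchSwinnertonDyer.Theorems.ManinLocalTwoThree

section Commute

variable (M : ℕ) {K : Type*} [CommRing K] {r q : ℕ} [NeZero r] [NeZero q] (hr : r.Prime) (hq : q.Prime)

/-- **`B_q B_r = B_r B_q` on boundary symbols** (`q, r ∤ M`): inverses of commuting operators commute. [folklore] -/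
theorem symbolShift_zero_comm (hM : ¬ r ∣ M) (hMq : ¬ q ∣ M) {Φ : OnePoint ℚ → OnePoint ℚ → K}
    (hΦ : Φ ∈ (cuspInvariants M K).map (boundaryOf K)) :
    symbolShift K (heckeNbrZero hq) (symbolShift K (heckeNbrZero hr) Φ) =
      symbolShift K (heckeNbrZero hr) (symbolShift K (heckeNbrZero hq) Φ) := by
  have h1 : symbolShift K (heckeNbrZero hr) Φ ∈ (cuspInvariants M K).map (boundaryOf K) :=
    symbolShift_heckeNbrZero_mem M hr hM hΦ
  have h2 : symbolShift K (heckeNbrZero hq) Φ ∈ (cuspInvariants M K).map (boundaryOf K) :=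
    symbolShift_heckeNbrZero_mem M hq hMq hΦ
  have h3 : symbolShift K (heckeNbrZero hq) (symbolShift K (heckeNbrZero hr) Φ) ∈ (cuspInvariants M K).map (boundaryOf K) :=
    symbolShift_heckeNbrZero_mem M hq hMq h1
  -- apply `A_r A_q` to both sides' candidates: `A_r A_q (B_q B_r Φ) = Φ = A_r A_q (B_r B_q Φ)`, then invert
  have e1 : symbolShift K (heckeNbrInfty hr) (symbolShift K (heckeNbrInfty hq)
      (symbolShift K (heckeNbrZero hq) (symbolShift K (heckeNbrZero hr) Φ))) = Φ := by
    rw [symbolShift_infty_zero M hq hMq h1, symbolShift_infty_zero M hr hM hΦ]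
  have e2 : symbolShift K (heckeNbrInfty hr) (symbolShift K (heckeNbrInfty hq)
      (symbolShift K (heckeNbrZero hr) (symbolShift K (heckeNbrZero hq) Φ))) = Φ := by
    rw [symbolShift_infty_comm M hq hr hMq hM (symbolShift_heckeNbrZero_mem M hr hM h2),
      symbolShift_infty_zero M hr hM h2, symbolShift_infty_zero M hq hMq hΦ]
  -- cancel `A_r A_q` by applying `B_q B_r`
  have h4 : symbolShift K (heckeNbrZero hr) (symbolShift K (heckeNbrZero hq) Φ) ∈ (cuspInvariants M K).map (boundaryOf K) :=
    symbolShift_heckeNbrZero_mem M hr hM h2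
  have cancel : ∀ Ψ ∈ (cuspInvariants M K).map (boundaryOf K), ∀ Θ ∈ (cuspInvariants M K).map (boundaryOf K),
      symbolShift K (heckeNbrInfty hr) (symbolShift K (heckeNbrInfty hq) Ψ) =
        symbolShift K (heckeNbrInfty hr) (symbolShift K (heckeNbrInfty hq) Θ) → Ψ = Θ := by
    intro Ψ hΨ Θ hΘ h
    have hΨ' := symbolShift_heckeNbrInfty_mem M hq hMq hΨ
    have hΘ' := symbolShift_heckeNbrInfty_mem M hq hMq hΘ
    have h' : symbolShift K (heckeNbrZero hq) (symbolShift K (heckeNbrZero hr)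
        (symbolShift K (heckeNbrInfty hr) (symbolShift K (heckeNbrInfty hq) Ψ))) =
        symbolShift K (heckeNbrZero hq) (symbolShift K (heckeNbrZero hr)
        (symbolShift K (heckeNbrInfty hr) (symbolShift K (heckeNbrInfty hq) Θ))) := by rw [h]
    rwa [symbolShift_zero_infty M hr hM hΨ', symbolShift_zero_infty M hr hM hΘ', symbolShift_zero_infty M hq hMq hΨ,
      symbolShift_zero_infty M hq hMq hΘ] at h'
  exact cancel _ h3 _ h4 (e1.trans e2.symm)

include hr hq in
/-- **`T_q T_r = T_r T_q` on boundary symbols of level `M`** (`q, r` primes `∤ M`). [cite: Shimura1971, Thm. 3.41] -/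
theorem symbolHecke_comm_of_mem (hM : ¬ r ∣ M) (hMq : ¬ q ∣ M) {Φ : OnePoint ℚ → OnePoint ℚ → K}
    (hΦ : Φ ∈ (cuspInvariants M K).map (boundaryOf K)) :
    symbolHecke M q K (symbolHecke M r K Φ) = symbolHecke M r K (symbolHecke M q K Φ) := by
  have hA : symbolShift K (heckeNbrInfty hr) Φ ∈ (cuspInvariants M K).map (boundaryOf K) :=
    symbolShift_heckeNbrInfty_mem M hr hM hΦ
  have hB : symbolShift K (heckeNbrZero hr) Φ ∈ (cuspInvariants M K).map (boundaryOf K) :=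
    symbolShift_heckeNbrZero_mem M hr hM hΦ
  have hA' : symbolShift K (heckeNbrInfty hq) Φ ∈ (cuspInvariants M K).map (boundaryOf K) :=
    symbolShift_heckeNbrInfty_mem M hq hMq hΦ
  have hB' : symbolShift K (heckeNbrZero hq) Φ ∈ (cuspInvariants M K).map (boundaryOf K) :=
    symbolShift_heckeNbrZero_mem M hq hMq hΦ
  rw [symbolHecke_eq_shift_of_mem M hr hM hΦ, map_add, map_smul,
    symbolHecke_eq_shift_of_mem M hq hMq hA, symbolHecke_eq_shift_of_mem M hq hMq hB,
    symbolHecke_eq_shift_of_mem M hq hMq hΦ, map_add, map_smul,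
    symbolHecke_eq_shift_of_mem M hr hM hA', symbolHecke_eq_shift_of_mem M hr hM hB',
    symbolShift_infty_comm M hr hq hM hMq hΦ, symbolShift_infty_zero_comm M hr hq hM hMq hΦ,
    ← symbolShift_infty_zero_comm M hq hr hMq hM hΦ, symbolShift_zero_comm M hr hq hM hMq hΦ]
  simp only [smul_add, smul_smul, mul_comm (q : K) (r : K)]
  abel

include hr hq in
/-- **`T_q` preserves `B_M ∩` (generalised `μ`-eigenspace of `T_r`)** (`q, r` primes `∤ M`). [cite: Shimura1971, Thm. 3.41] -/
theorem symbolHecke_mem_maxGenEigenspace (hM : ¬ r ∣ M) (hMq : ¬ q ∣ M) {Φ : OnePoint ℚ → OnePoint ℚ → K}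
    (hΦ : Φ ∈ (cuspInvariants M K).map (boundaryOf K)) {μ : K}
    (hgen : Φ ∈ Module.End.maxGenEigenspace (symbolHecke M r K) μ) :
    symbolHecke M q K Φ ∈ Module.End.maxGenEigenspace (symbolHecke M r K) μ := by
  rw [symbolHecke_eq_shift_of_mem M hq hMq hΦ]
  refine Submodule.add_mem _ (symbolShift_mem_maxGenEigenspace M hr hq hM hMq hΦ hgen) (Submodule.smul_mem _ _ ?_)
  -- `B_q` preserves the generalised eigenspace too: `(T_r − μ)^k` commutes with `B_q` on `B_M` (induction on `k`)
  rw [Module.End.mem_maxGenEigenspace] at hgen ⊢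
  obtain ⟨k, hk⟩ := hgen
  refine ⟨k, ?_⟩
  have key : ∀ n : ℕ, ∀ Ψ ∈ (cuspInvariants M K).map (boundaryOf K),
      ((symbolHecke M r K - μ • 1) ^ n) Ψ ∈ (cuspInvariants M K).map (boundaryOf K) ∧
      ((symbolHecke M r K - μ • 1) ^ n) (symbolShift K (heckeNbrZero hq) Ψ) =
        symbolShift K (heckeNbrZero hq) (((symbolHecke M r K - μ • 1) ^ n) Ψ) := by
    intro n
    induction n with
    | zero =>
      intro Ψ hΨ
      refine ⟨?_, ?_⟩
      · simpa only [pow_zero, Module.End.one_apply] using hΨ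
      · simp only [pow_zero, Module.End.one_apply]
    | succ n ih =>
      intro Ψ hΨ
      have hΨ1 : (symbolHecke M r K - μ • 1) Ψ ∈ (cuspInvariants M K).map (boundaryOf K) := by
        rw [LinearMap.sub_apply, LinearMap.smul_apply, Module.End.one_apply]
        exact Submodule.sub_mem _ (symbolHecke_mem M hr hM hΨ) (Submodule.smul_mem _ _ hΨ)
      obtain ⟨ihmem, iheq⟩ := ih _ hΨ1
      refine ⟨?_, ?_⟩
      · rw [pow_succ, Module.End.mul_apply]
        exact ihmem
      · rw [pow_succ, Module.End.mul_apply, Module.End.mul_apply, ← iheq]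
        congr 1
        rw [LinearMap.sub_apply, LinearMap.sub_apply, LinearMap.smul_apply, LinearMap.smul_apply,
          Module.End.one_apply, Module.End.one_apply, map_sub, map_smul,
          symbolHecke_eq_shift_of_mem M hr hM (symbolShift_heckeNbrZero_mem M hq hMq hΨ),
          symbolHecke_eq_shift_of_mem M hr hM hΨ, map_add, map_smul,
          ← symbolShift_infty_zero_comm M hq hr hMq hM hΨ, symbolShift_zero_comm M hq hr hMq hM hΨ]
  rw [(key k Φ hΦ).2, hk, map_zero]

end Commute

end Summit.BirchSwinnertonDyer.BirchSwinnertonDyer.Theorems.ManinLocalTwoThree
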